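import Summits.ValiantsHypothesis.ValiantsHypothesis.Theorems.DepthWindowTreeBiasDichotomy

/-!
# Route `DepthWindow` — universal low PATH bias (`ULPB_C`): the formula-strength sequel of `ULB₂`

Cone-free file (decomp-valiant lens 4, g16) supporting the crux item `HomImmHardTwoOne`
(stmt-ValiantsHypothesis-30635).  `ULB₂` (`universalLowBiasAt_two`, g16) caps every NODE bias by `O(h)` at
depth `2·log₂log₂ d + 3`, hence the PATH bias (LST's `Treebias_Δ`) by `O(h·Δ)`; that closes the route's door
(circuits, via unrolling, need `Treebias/(Δ·h) → ∞`) but leaves the FORMULA-strength question open: LST 2022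
Thm. 3 gives `relrk_W` lower bounds `n^{Θ(Treebias_Δ(W)/h)}` for set-multilinear formulas, so the method is dead
at slope `2` for formulas as well iff `max_W Treebias_Δ(W) = O(h)` there.  This file TYPES that statement:

* `UniversalLowPathBiasAt C` (`ULPB_C`, conjecture): constants `B, c₁` such that every integer word with letters
  and total in `[-h, h]` has, at every depth `Δ ≥ C·⌊log₂⌊log₂ d⌋⌋ + c₁`, a tree all of whose PATH biases are
  `< B·h` — i.e. `¬ TreeBiasGe w Δ (B·h)`;
* `universalLowBiasAt_of_path` — `ULPB_C → ULB_C` (a path bias bounds the bias of its end node, LST Prop. 17);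
* `two_le_of_universalLowPathBiasAt` — hence `ULPB_C → 2 ≤ C` (g14: `ULB₀`, `ULB₁` fail).

`ULPB₂` is the workshop's next conjecture (NODE-v16 §5.2, lens 4): the g16 two-level builder with a single
imbalance CARRIER (untrimmed targets above `K·e` are merged into one block whose distance `D = |S_C − Σ w|` to
the total is a potential: each inflow `m` satisfies `m ≤ 3·(D_i − D_{i+1})`) and extraction masses `64h/(i+1)²`
(summable, while the scale still squares: `L_{i+1} = 2L_i − 2log₂(i+1) + O(1)`) is claimed to give path bias
`O(h)`; simulation `pathsim.py` (HOME decomp-val-lens-4/v16) agrees on all tested words.  If true it answers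
LST 2022 Question 1 in the large-depth regime: `max_W Treebias_Δ(W) = Θ(1)` from `Δ = 2log₂log₂ d + O(1)` on
(and `→ ∞` below `(log_φ 2)·log₂log₂ d`, BDS 2024 Thm. 2).

APPEND-ONLY CORRECTION (same generation, before any use): the first typing `UniversalLowPathBiasAt` ends in
`¬ TreeBiasGe w Δ (B·h)`, which FAILS for the zero word (`h = 0`: `TreeBiasGe 0 Δ 0` holds trivially, since
off-path costs are `≥ 0`) — `not_universalLowPathBiasAt` records this for every `C`, so that decl is vacuous and
DEPRECATED.  The intended statement is `Treebias_Δ(w) ≤ B·h`, i.e. `¬ TreeBiasGe w Δ (B·h + 1)`: this is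
`UniversalLowTreeBiasAt C` below (`ULPB_C` henceforth), with the same three consequences re-proved
(`universalLowBiasAt_of_treeBias`, `two_le_of_universalLowTreeBiasAt`, `not_universalLowTreeBiasAt_one`) and the
non-vacuity check `not_treeBiasGe_zero_one`.

References: [LimayeSrinivasanTavenas2022] CCC 2022 Def. 2, Thm. 3, Question 1; full version Prop. 17;
[BhargavDuttaSaxena2024] Thm. 2, Thm. 3.
-/

-- layout Summits/ValiantsHypothesis/ValiantsHypothesis forces the duplicated namespace component
set_option linter.dupNamespace false

namespace Summit.ValiantsHypothesis.ValiantsHypothesis.Theorems.DepthWindow.TreeBias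

open Finset Literature.Computability.AlgebraicComplexity

/-- **Conjecture `ULPB_C` (universal low PATH bias at depth slope `C`).**  There are constants `B, c₁` such
that every integer word `w` on `d` letters with `|w_i| ≤ h` and `|Σ w| ≤ h` has, at every depth
`Δ ≥ C·⌊log₂⌊log₂ d⌋⌋ + c₁`, tree bias `< B·h`: some depth-`Δ` tree (single block on top) all of whose internal
paths have bias `< B·h`.  Stronger than `ULB_C` (`universalLowBiasAt_of_path`); FALSE for `C ≤ 1`
(`two_le_of_universalLowPathBiasAt`); `ULPB₂` OPEN — workshop conjecture (NODE-v16 §5.2, lens 4: carrier +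
decaying masses).  Through LST 2022 Thm. 3 it says the lopsided relative-rank method proves nothing
super-polynomial for set-multilinear FORMULAS of product-depth `≥ C·log₂log₂ d + c₁`.
[cite: LimayeSrinivasanTavenas2022, Question 1, Thm. 3] [cite: BhargavDuttaSaxena2024, Thm. 3] -/
@[conjecture] def UniversalLowPathBiasAt (C : ℕ) : Prop :=
  ∃ B c₁ : ℕ, ∀ (d : ℕ) (w : Fin d → ℤ) (h : ℕ), (∀ i, |w i| ≤ h) → |∑ i, w i| ≤ h →
    ∀ Δ : ℕ, C * Nat.log 2 (Nat.log 2 d) + c₁ ≤ Δ → ¬ TreeBiasGe w Δ (B * h)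

/-- **`ULPB_C → ULB_C`**: a tree all of whose path biases are `< B·h` has all node biases `≤ (B+1)·h`, since the
bias of the path ending at a node is at least that node's bias minus `|Σ w| ≤ h` (LST Prop. 17, first
inequality, `nodeBias_le_offCost`). [cite: LimayeSrinivasanTavenas2022, Prop. 17] -/
theorem universalLowBiasAt_of_path {C : ℕ} (hP : UniversalLowPathBiasAt C) : UniversalLowBiasAt C := by
  obtain ⟨B, c₁, hB⟩ := hP
  refine ⟨B + 1, c₁, fun d w h hw hsum => ?_⟩
  have hnot := hB d w h hw hsum _ le_rfl
  -- `¬ TreeBiasGe`: some tree with a single top block and no internal path of bias `≥ B·h`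
  simp only [TreeBiasGe, not_forall] at hnot
  obtain ⟨T, hroot, hno⟩ := hnot
  refine ⟨T, hroot, fun u hu1 huΔ i => ?_⟩
  by_contra hlt
  rw [not_le] at hlt
  apply hno
  refine ⟨u, i, hu1, huΔ, ?_⟩
  have h1 := nodeBias_le_offCost w T huΔ i
  push_cast at hlt ⊢
  nlinarith [h1, hlt, hsum, abs_nonneg (∑ j, w j)]

/-- **`ULPB_C` fails for `C ≤ 1`**: it would give `ULB_C`, refuted at `C = 0, 1` by the golden-ratio words
(g14, `universalLowBiasAt_iff`). [cite: BhargavDuttaSaxena2024, Thm. 2] -/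
theorem two_le_of_universalLowPathBiasAt {C : ℕ} (hP : UniversalLowPathBiasAt C) : 2 ≤ C :=
  universalLowBiasAt_iff.1 (universalLowBiasAt_of_path hP)

/-- In particular `¬ ULPB₁`: at slope `1` some words force path bias `≥ B·h` for every `B`. [cite:
BhargavDuttaSaxena2024, Thm. 2] -/
theorem not_universalLowPathBiasAt_one : ¬ UniversalLowPathBiasAt 1 := fun h =>
  absurd (two_le_of_universalLowPathBiasAt h) (by norm_num)


/-! ### Correction (append-only): the vacuous first typing, and `ULPB_C` as `Treebias ≤ B·h` -/

/-- **The first typing is vacuous**: `UniversalLowPathBiasAt C` fails for every `C`, witnessed by the zero word on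
one letter (`h = 0`, threshold `B·0 = 0`, and every tree has a path of bias `≥ 0`).  DEPRECATED in favour of
`UniversalLowTreeBiasAt`. [folklore] -/
theorem not_universalLowPathBiasAt (C : ℕ) : ¬ UniversalLowPathBiasAt C := by
  rintro ⟨B, c₁, hB⟩
  have h := hB 1 (fun _ => 0) 0 (fun _ => by simp) (by simp) (C * Nat.log 2 (Nat.log 2 1) + c₁ + 1) (by omega)
  apply h
  intro T _
  refine ⟨C * Nat.log 2 (Nat.log 2 1) + c₁ + 1, 0, by omega, le_rfl, ?_⟩
  have h1 := nodeBias_le_offCost (fun _ : Fin 1 => (0 : ℤ)) T (le_refl (C * Nat.log 2 (Nat.log 2 1) + c₁ + 1)) 0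
  have h2 := nodeBias_nonneg (fun _ : Fin 1 => (0 : ℤ)) T (C * Nat.log 2 (Nat.log 2 1) + c₁ + 1) 0
  simp only [mul_zero, Nat.cast_zero, sum_const_zero, abs_zero, sub_zero]
  linarith

/-- **Conjecture `ULPB_C` (universal low TREE bias at depth slope `C`)** — the corrected typing.  There are
constants `B, c₁` such that every integer word `w` on `d` letters with `|w_i| ≤ h` and `|Σ w| ≤ h` has, at every
depth `Δ ≥ C·⌊log₂⌊log₂ d⌋⌋ + c₁`, tree bias `≤ B·h` (`¬ TreeBiasGe w Δ (B·h + 1)`): some depth-`Δ` tree (single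
block on top) all of whose internal paths have bias `≤ B·h`.  Stronger than `ULB_C`
(`universalLowBiasAt_of_treeBias`); FALSE for `C ≤ 1` (`two_le_of_universalLowTreeBiasAt`); non-vacuous at
`h = 0` (`not_treeBiasGe_zero_one`); `ULPB₂` OPEN — workshop conjecture (NODE-v16 §4b/§5.2, lens 4: single
imbalance carrier + decaying extraction masses).  Through LST 2022 Thm. 3 it says the lopsided relative-rank
method proves nothing super-polynomial for set-multilinear FORMULAS of product-depth `≥ C·log₂log₂ d + c₁`.
[cite: LimayeSrinivasanTavenas2022, Question 1, Thm. 3] [cite: BhargavDuttaSaxena2024, Thm. 3] -/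
@[conjecture] def UniversalLowTreeBiasAt (C : ℕ) : Prop :=
  ∃ B c₁ : ℕ, ∀ (d : ℕ) (w : Fin d → ℤ) (h : ℕ), (∀ i, |w i| ≤ h) → |∑ i, w i| ≤ h →
    ∀ Δ : ℕ, C * Nat.log 2 (Nat.log 2 d) + c₁ ≤ Δ → ¬ TreeBiasGe w Δ (B * h + 1)

/-- **`ULPB_C → ULB_C`**: a tree all of whose path biases are `≤ B·h` has all node biases `≤ (B+1)·h`, since the
bias of the path ending at a node is at least that node's bias minus `|Σ w| ≤ h` (LST Prop. 17, first
inequality, `nodeBias_le_offCost`). [cite: LimayeSrinivasanTavenas2022, Prop. 17] -/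
theorem universalLowBiasAt_of_treeBias {C : ℕ} (hP : UniversalLowTreeBiasAt C) : UniversalLowBiasAt C := by
  obtain ⟨B, c₁, hB⟩ := hP
  refine ⟨B + 1, c₁, fun d w h hw hsum => ?_⟩
  have hnot := hB d w h hw hsum _ le_rfl
  -- `¬ TreeBiasGe`: some tree with a single top block and no internal path of bias `≥ B·h + 1`
  simp only [TreeBiasGe, not_forall] at hnot
  obtain ⟨T, hroot, hno⟩ := hnot
  refine ⟨T, hroot, fun u hu1 huΔ i => ?_⟩
  by_contra hlt
  rw [not_le] at hlt
  apply hno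
  refine ⟨u, i, hu1, huΔ, ?_⟩
  have h1 := nodeBias_le_offCost w T huΔ i
  push_cast at hlt ⊢
  nlinarith [h1, hlt, hsum, abs_nonneg (∑ j, w j)]

/-- **`ULPB_C` fails for `C ≤ 1`**: it would give `ULB_C`, refuted at `C = 0, 1` by the golden-ratio words
(g14, `universalLowBiasAt_iff`). [cite: BhargavDuttaSaxena2024, Thm. 2] -/
theorem two_le_of_universalLowTreeBiasAt {C : ℕ} (hP : UniversalLowTreeBiasAt C) : 2 ≤ C :=
  universalLowBiasAt_iff.1 (universalLowBiasAt_of_treeBias hP)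

/-- In particular `¬ ULPB₁`: at slope `1` some words have tree bias `> B·h` for every `B`.
[cite: BhargavDuttaSaxena2024, Thm. 2] -/
theorem not_universalLowTreeBiasAt_one : ¬ UniversalLowTreeBiasAt 1 := fun h =>
  absurd (two_le_of_universalLowTreeBiasAt h) (by norm_num)

/-- Non-vacuity of the threshold `B·h + 1` (sanity): the zero word (`h = 0`) has tree bias `0`, so
`¬ TreeBiasGe 0 Δ 1` at every depth `Δ ≥ 1` — the instance that kills the first typing is harmless for
`UniversalLowTreeBiasAt`. [folklore] -/
theorem not_treeBiasGe_zero_one (d : ℕ) {Δ : ℕ} (hΔ : 1 ≤ Δ) : ¬ TreeBiasGe (fun _ : Fin d => (0 : ℤ)) Δ 1 := by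
  intro h
  obtain ⟨t, i, -, -, hle⟩ := h (starTree d) fun i j => by simp [starTree, Nat.pos_iff_ne_zero.1 hΔ]
  have h0 : offCost (fun _ : Fin d => (0 : ℤ)) (starTree d) Δ t i = 0 := by simp [offCost, blockSum]
  rw [h0] at hle
  simp at hle

end Summit.ValiantsHypothesis.ValiantsHypothesis.Theorems.DepthWindow.TreeBias
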